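import Mathlib.Analysis.SpecialFunctions.Pow.Real
import Mathlib.Data.Set.Card
import Literature.Computability.MetaComplexity.ChenJinWilliams2019.SparseMagnification
import Literature.Computability.Complexity.NTIMEPadding
import Literature.Computability.Complexity.NPClosureProofs
import Literature.Computability.Complexity.CircuitClassesProofs
import Literature.Computability.Complexity.StringEquality
import Literature.Computability.Complexity.StringCopy
import HarnessLib

/-!
# Chen–Jin–Williams 2019, Theorem 1.1, converse of item 1 (`C = NP`) — proved

Discharge (D-0014) of the vendored named fact
`Literature.Computability.MetaComplexity.ChenJinWilliams2019.thm11_circuit_NP_converse`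
(`SparseMagnification.lean`): `NPNotInFixedPolySize → ∃ ε > 0, SparseNPHardAt ε`, i.e. if for
every `k` some `NP` language has circuit complexity not `O(n^k)`, then for every `β ∈ (0,1)` some
`2^{n^β}`-sparse `NP` language has circuit complexity not `O(n^{1+ε})` (here with `ε = 1`).

Printed proof (L. Chen, C. Jin, R. R. Williams, *Hardness Magnification for all Sparse NP
Languages*, FOCS 2019; full version ECCC TR19-118, §3 p. 14, verbatim): *"The ⇐ direction can be
proved by a simple padding argument. Set `ε = 1`. For every `β ∈ (0, 1)`, by assumption, there is a
language `L_β ∈ NP` without `n^{2/β}` size circuits. Then we can define another language `L'_β ∈ NP`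
as `{x10^{|x|^{1/β}−|x|−1} | x ∈ L_β}`. Clearly, `L'_β` does not have `n^{1+ε} = n²` size
circuits, and it is a `2^{n^β}`-sparse language."*

## The formal proof (same argument, tree vocabulary)

Fix `β ∈ (0,1)`, put `q := ⌈1/β⌉` (so `1 ≤ q` and `q·β ≥ 1`) and take, by `NPNotInFixedPolySize`
at `k := 2q`, an `NP` language `L` with `∀ c, L ∉ SIZE(c·n^{2q} + c)`. The padded language is the
image `polyPad q '' L = {⟨x, 1^{|x|^q}⟩ | x ∈ L}` under the tree's polynomial pad
(`NTIMEPadding.lean`, pair code `boolPair`, `|polyPad q x| = 2|x| + 2 + |x|^q`).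

* `NP`: `polyPad q '' L = {z | z = polyPad q (fst z)} ∩ fst⁻¹(L)` — a `P` test
  (`setOf_apply_eq_apply_mem_P`) intersected with an `FP`-preimage of `L` (`preimage_mem_NP`,
  `inter_P_mem_polyExists`).
* Sparsity: `n ↦ 2n + 2 + n^q` is injective, so the words of length `N` in the image are pads of
  words of ONE length `n`, at most `2ⁿ ≤ 2^{N^β}` of them (`N^β ≥ n^{qβ} ≥ n`).
* Hardness: a `B₂`-circuit of size `c·N² + c` for the padded language at length `N = 2n+2+n^q`,
  fed with the wiring `u ↦ pairVec u 1^{n^q}` (`cktSize_pairVec`, `CktSize.hardwire`: `N + 2`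
  extra gates), decides `L` at length `n` with `≤ 30(c+1)·n^{2q} + 30(c+1)` gates — contradiction.

Main results: `sparseNPHardAt_one_of_NPNotInFixedPolySize` (the quantitative form, `ε = 1`),
`thm11_circuit_NP_converse_holds : thm11_circuit_NP_converse`, and the hypothesis-reduced
equivalence `sparseNPHard_iff_of_thm11` (only the magnification direction `thm11_circuit_NP`
remains a named fact).

## References

* L. Chen, C. Jin, R. R. Williams, *Hardness Magnification for all Sparse NP Languages*, FOCS 2019,
  1240–1255; ECCC TR19-118, Thm. 1.1 and §3 (p. 14, "The ⇐ direction"). [bib: ChenJinWilliams2019]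
* S. Arora, B. Barak, *Computational Complexity: A Modern Approach*, CUP 2009, §2.6.2 (padding),
  §6.1 (circuit families).
-/

noncomputable section

namespace Literature.Computability.MetaComplexity.ChenJinWilliams2019

open Literature.Computability.Complexity Literature.Computability.Complexity.Nondeterministic
open Literature.Computability.Complexity.Brick

/-! ### The padded language `polyPad q '' L` -/

/-- `polyPad q` is injective (its first component is the payload). [folklore] -/
private theorem polyPad_injective (q : ℕ) : Function.Injective (polyPad q) := fun x y h => by
  simpa using congrArg fstF h

/-- A pad lies in the padded language iff its payload lies in `L`. [folklore] -/
private theorem polyPad_mem_image_iff {q : ℕ} {L : Language Bool} {x : List Bool} :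
    polyPad q x ∈ polyPad q '' L ↔ x ∈ L :=
  (polyPad_injective q).mem_set_image

/-- The padded language as "valid pad whose payload is in `L`":
`polyPad q '' L = {z | z = polyPad q (fst z)} ∩ fst⁻¹ L`. [folklore] -/
private theorem image_polyPad_eq (q : ℕ) (L : Language Bool) :
    polyPad q '' L = ({z : List Bool | z = polyPad q (fstF z)} ⊓ (fstF ⁻¹' L) : Language Bool) := by
  ext z
  change (∃ x, x ∈ L ∧ polyPad q x = z) ↔ z = polyPad q (fstF z) ∧ fstF z ∈ L
  constructor
  · rintro ⟨x, hx, rfl⟩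
    exact ⟨by rw [fstF_polyPad], by rwa [fstF_polyPad]⟩
  · rintro ⟨h1, h2⟩
    exact ⟨fstF z, h2, h1.symm⟩

/-- The indicator of the padded language at a pad is the indicator of `L` at the payload. [folklore] -/
private theorem boolIndicator_image_polyPad (q : ℕ) (L : Language Bool) (x : List Bool) :
    (polyPad q '' L).boolIndicator (polyPad q x) = (L : Set (List Bool)).boolIndicator x := by
  by_cases hx : x ∈ L
  · rw [((polyPad q '' L).mem_iff_boolIndicator _).1 (polyPad_mem_image_iff.2 hx),
      ((L : Set (List Bool)).mem_iff_boolIndicator _).1 hx]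
  · rw [((polyPad q '' L).notMem_iff_boolIndicator _).1
        (fun h => hx (polyPad_mem_image_iff.1 h)),
      ((L : Set (List Bool)).notMem_iff_boolIndicator _).1 hx]

/-! ### `NP` membership (print: "`L'_β ∈ NP`") -/

/-- **The padded language of an `NP` language is in `NP`**: test that the input is a valid pad
(a `P` test, `padValid`) and that its payload is in `L` (an `FP`-preimage).
[cite: ChenJinWilliams2019, Thm. 1.1 (converse of item 1), TR19-118 p. 14] -/
theorem image_polyPad_mem_NP (q : ℕ) {L : Language Bool} (hL : L ∈ NP) :
    polyPad q '' L ∈ NP := by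
  have hP : ({z : List Bool | z = polyPad q (fstF z)} : Language Bool) ∈ Classes.P := by
    have h := setOf_apply_eq_apply_mem_P OracleCompose.id_mem_FP
      (comp_mem_FP (polyPad_mem_FP q) fstF_mem_FP)
    exact h
  rw [image_polyPad_eq]
  exact inter_P_mem_polyExists (K := Classes.P) (fun _ _ c d => inter_mem_P c d) hP
    (preimage_mem_NP hL fstF_mem_FP)

/-! ### Sparsity (print: "it is a `2^{n^β}`-sparse language") -/

/-- The pad length `n ↦ 2n + 2 + n^q` is strictly increasing. [folklore] -/
private theorem strictMono_padLength (q : ℕ) : StrictMono fun n : ℕ => 2 * n + 2 + n ^ q := by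
  refine strictMono_nat_of_lt_succ fun n => ?_
  have : n ^ q ≤ (n + 1) ^ q := Nat.pow_le_pow_left (Nat.le_succ n) q
  show 2 * n + 2 + n ^ q < 2 * (n + 1) + 2 + (n + 1) ^ q
  omega

/-- The words of the padded language of the length of `polyPad q x₀` are pads of words of length
`|x₀|`: at most `2^{|x₀|}` of them. [folklore] -/
private theorem ncard_slice_image_polyPad_le (q : ℕ) (L : Language Bool) (x₀ : List Bool) :
    {w : List Bool | w ∈ polyPad q '' L ∧ w.length = (polyPad q x₀).length}.ncard ≤
      2 ^ x₀.length := by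
  set n := x₀.length with hn
  have hsub : {w : List Bool | w ∈ polyPad q '' L ∧ w.length = (polyPad q x₀).length} ⊆
      (fun v : List.Vector Bool n => polyPad q v.toList) '' Set.univ := by
    rintro w ⟨⟨x, -, rfl⟩, hw⟩
    have hxl : x.length = n := by
      rw [length_polyPad, length_polyPad, ← hn] at hw
      exact (strictMono_padLength q).injective hw
    exact ⟨⟨x, hxl⟩, Set.mem_univ _, rfl⟩
  have hfin : ((fun v : List.Vector Bool n => polyPad q v.toList) '' Set.univ).Finite :=
    Set.finite_univ.image _
  calc {w : List Bool | w ∈ polyPad q '' L ∧ w.length = (polyPad q x₀).length}.ncard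
      ≤ ((fun v : List.Vector Bool n => polyPad q v.toList) '' Set.univ).ncard :=
        Set.ncard_le_ncard hsub hfin
    _ ≤ (Set.univ : Set (List.Vector Bool n)).ncard := Set.ncard_image_le Set.finite_univ
    _ = 2 ^ n := by
        rw [Set.ncard_univ, Nat.card_eq_fintype_card, card_vector, Fintype.card_bool]

/-- The exponent bookkeeping of the sparsity claim: with `q·β ≥ 1`,
`2ⁿ ≤ ⌊2^{N^β}⌋` for `N = 2n + 2 + n^q` (since `N^β ≥ (n^q)^β = n^{qβ} ≥ n`). [folklore] -/
private theorem two_pow_le_expSparsity {β : ℝ} (hβ : 0 < β) {q : ℕ} (hqβ : 1 ≤ (q : ℝ) * β)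
    (n : ℕ) :
    2 ^ n ≤ expSparsity β (2 * n + 2 + n ^ q) := by
  unfold expSparsity
  refine Nat.le_floor ?_
  rw [Nat.cast_pow, Nat.cast_ofNat, ← Real.rpow_natCast 2 n]
  refine Real.rpow_le_rpow_of_exponent_le (by norm_num) ?_
  rcases Nat.eq_zero_or_pos n with rfl | hn
  · simp only [Nat.cast_zero]
    exact Real.rpow_nonneg (by positivity) _
  · have hn1 : (1 : ℝ) ≤ n := by exact_mod_cast hn
    have hle : ((n ^ q : ℕ) : ℝ) ≤ ((2 * n + 2 + n ^ q : ℕ) : ℝ) := by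
      exact_mod_cast Nat.le_add_left (n ^ q) (2 * n + 2)
    calc (n : ℝ) = (n : ℝ) ^ (1 : ℝ) := (Real.rpow_one _).symm
      _ ≤ (n : ℝ) ^ ((q : ℝ) * β) := Real.rpow_le_rpow_of_exponent_le hn1 hqβ
      _ = ((n : ℝ) ^ (q : ℝ)) ^ β := Real.rpow_mul (by positivity) _ _
      _ = ((n ^ q : ℕ) : ℝ) ^ β := by rw [Real.rpow_natCast, Nat.cast_pow]
      _ ≤ ((2 * n + 2 + n ^ q : ℕ) : ℝ) ^ β := Real.rpow_le_rpow (by positivity) hle hβ.le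

/-- **The padded language is `2^{n^β}`-sparse** when `q·β ≥ 1`.
[cite: ChenJinWilliams2019, Thm. 1.1 (converse of item 1), TR19-118 p. 14] -/
theorem isSparse_image_polyPad {β : ℝ} (hβ : 0 < β) {q : ℕ} (hqβ : 1 ≤ (q : ℝ) * β)
    (L : Language Bool) : IsSparse (expSparsity β) (polyPad q '' L) := by
  intro N
  change {w : List Bool | w ∈ polyPad q '' L ∧ w.length = N}.ncard ≤ _
  by_cases hN : ∃ x₀ : List Bool, (polyPad q x₀).length = N
  · obtain ⟨x₀, rfl⟩ := hN
    calc {w : List Bool | w ∈ polyPad q '' L ∧ w.length = (polyPad q x₀).length}.ncard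
        ≤ 2 ^ x₀.length := ncard_slice_image_polyPad_le q L x₀
      _ ≤ expSparsity β (2 * x₀.length + 2 + x₀.length ^ q) := two_pow_le_expSparsity hβ hqβ _
      _ = expSparsity β (polyPad q x₀).length := by rw [length_polyPad]
  · have : {w : List Bool | w ∈ polyPad q '' L ∧ w.length = N} = ∅ := by
      ext w
      simp only [Set.mem_setOf_eq, Set.mem_empty_iff_false, iff_false, not_and]
      rintro ⟨x, -, rfl⟩ hlen
      exact hN ⟨x, hlen⟩
    rw [this, Set.ncard_empty]
    exact Nat.zero_le _

/-! ### Hardness transfer (print: "`L'_β` does not have `n²` size circuits") -/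

/-- `⌈N^{1+1}⌉ = N²`. [folklore] -/
private theorem ceil_rpow_one_add_one (N : ℕ) : ⌈(N : ℝ) ^ ((1 : ℝ) + 1)⌉₊ = N ^ 2 := by
  rw [show (1 : ℝ) + 1 = 2 by norm_num, Real.rpow_two, ← Nat.cast_pow, Nat.ceil_natCast]

/-- At `ε = 1` the super-linear size bound is `c·N² + c`. [folklore] -/
private theorem superlinearBound_one (c N : ℕ) : superlinearBound 1 c N = c * N ^ 2 + c := by
  show c * ⌈(N : ℝ) ^ ((1 : ℝ) + 1)⌉₊ + c = c * N ^ 2 + c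
  rw [ceil_rpow_one_add_one]

/-- Size bookkeeping of the transfer: for `1 ≤ q` and `N = 2n + 2 + n^q`,
`N + (c·N² + c) + 2 ≤ 30(c+1)·n^{2q} + 30(c+1)`. [folklore] -/
private theorem padSize_le {q : ℕ} (hq : 1 ≤ q) (c n : ℕ) :
    2 * n + 2 + n ^ q + (c * (2 * n + 2 + n ^ q) ^ 2 + c) + 2 ≤
      polyBound (2 * q) (30 * (c + 1)) n := by
  show _ ≤ 30 * (c + 1) * n ^ (2 * q) + 30 * (c + 1)
  rw [pow_mul']
  rcases Nat.eq_zero_or_pos n with rfl | hn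
  · have hq0 : (0 : ℕ) ^ q = 0 := Nat.zero_pow hq
    rw [hq0]
    nlinarith
  · have hnM : n ≤ n ^ q := Nat.le_self_pow (by omega) n
    have hM1 : 1 ≤ n ^ q := by omega
    have hN : 2 * n + 2 + n ^ q ≤ 5 * n ^ q := by omega
    have hN2 : (2 * n + 2 + n ^ q) ^ 2 ≤ 25 * (n ^ q) ^ 2 := by nlinarith
    nlinarith

/-- **Hardness transfer by padding.** If the padded language `polyPad q '' L` (`1 ≤ q`) has
`B₂`-circuits of size `c·N² + c` at every length `N`, then `L` has circuits of size
`30(c+1)·n^{2q} + 30(c+1)`: at length `n`, wire the input `u` and the constant pad `1^{n^q}` into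
the circuit for length `N = 2n + 2 + n^q` (`N + 2` extra gates for the pair code and the constants).
[cite: ChenJinWilliams2019, Thm. 1.1 (converse of item 1), TR19-118 p. 14] -/
theorem mem_SIZE_of_image_polyPad_mem_SIZE {q : ℕ} (hq : 1 ≤ q) {L : Language Bool} {c : ℕ}
    (h : polyPad q '' L ∈ SIZE (superlinearBound 1 c)) :
    L ∈ SIZE (polyBound (2 * q) (30 * (c + 1))) := by
  simp only [SIZE] at h
  obtain ⟨C, hC, hdec⟩ := h
  have main : ∀ n : ℕ, ∃ D : Circuit (Fin n), D.IsOver B2 ∧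
      D.size ≤ polyBound (2 * q) (30 * (c + 1)) n ∧
      ∀ u : Fin n → Bool, D.eval u = (L : Set (List Bool)).boolIndicator (List.ofFn u) := by
    intro n
    have h1 := cktSize_pairVec n (n ^ q)
    have h2 := ((C (2 * n + 2 + n ^ q)).cktSize_eval (hC _).1).of_le (hC _).2
    have h3 := (h1.comp h2).hardwire (fun _ : Fin (n ^ q) => true)
    obtain ⟨D, hDB, hDs, hDe⟩ := h3.toCircuit
    refine ⟨D, hDB, ?_, fun u => ?_⟩
    · refine hDs.trans ?_
      rw [superlinearBound_one]
      exact padSize_le hq c n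
    · rw [hDe u]
      simp only [Sum.elim_inl, Sum.elim_inr]
      rw [hdec.eval_eq, ofFn_pairVec, List.ofFn_const]
      have hpad : boolPair (List.ofFn u) (List.replicate (n ^ q) true) =
          polyPad q (List.ofFn u) := by
        rw [polyPad, List.length_ofFn]
      rw [hpad, boolIndicator_image_polyPad]
  choose D hD using main
  refine ⟨D, fun n => ⟨(hD n).1, (hD n).2.1⟩, fun x => ?_⟩
  have := (hD x.length).2.2 x.get
  rwa [List.ofFn_get] at this

/-! ### The named fact -/

/-- **Chen–Jin–Williams 2019, Thm. 1.1, converse of item 1 (`C = NP`), quantitative form with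
`ε = 1`:** if for every `k` some `NP` language has circuit complexity not `O(n^k)`, then for every
`β ∈ (0,1)` some `2^{n^β}`-sparse `NP` language has circuit complexity not `O(n²)` — namely the
pad `{⟨x, 1^{|x|^q}⟩ | x ∈ L}`, `q = ⌈1/β⌉`, of an `NP` language `L` that is not in
`SIZE(c·n^{2q} + c)` for any `c`. Printed: TR19-118 §3 p. 14, "The ⇐ direction can be proved by
a simple padding argument. Set `ε = 1`. …". [cite: ChenJinWilliams2019, Thm. 1.1 (converse of item 1), TR19-118 p. 14] -/
theorem sparseNPHardAt_one_of_NPNotInFixedPolySize (h : NPNotInFixedPolySize) :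
    SparseNPHardAt 1 := by
  intro β hβ0 _hβ1
  have hq : 1 ≤ ⌈1 / β⌉₊ := Nat.ceil_pos.2 (by positivity)
  have hqβ : 1 ≤ (⌈1 / β⌉₊ : ℝ) * β := by
    have h1 : 1 / β ≤ (⌈1 / β⌉₊ : ℝ) := Nat.le_ceil (1 / β)
    calc (1 : ℝ) = 1 / β * β := by field_simp
      _ ≤ (⌈1 / β⌉₊ : ℝ) * β := mul_le_mul_of_nonneg_right h1 hβ0.le
  obtain ⟨L, hL, hhard⟩ := h (2 * ⌈1 / β⌉₊)
  exact ⟨polyPad ⌈1 / β⌉₊ '' L, image_polyPad_mem_NP _ hL, isSparse_image_polyPad hβ0 hqβ L,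
    fun c hc => hhard _ (mem_SIZE_of_image_polyPad_mem_SIZE hq hc)⟩

/-- **Discharge of the named fact `thm11_circuit_NP_converse`** (Chen–Jin–Williams 2019, Thm. 1.1,
"Moreover, the converse of each item above also holds", item 1, `C = NP`): `NPNotInFixedPolySize →
∃ ε > 0, SparseNPHardAt ε`, with `ε = 1`. [cite: ChenJinWilliams2019, Thm. 1.1 (converse of item 1), TR19-118 pp. 4, 14] -/
theorem thm11_circuit_NP_converse_holds : thm11_circuit_NP_converse :=
  fun h => ⟨1, one_pos, sparseNPHardAt_one_of_NPNotInFixedPolySize h⟩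

/-- Every `ε ∈ (0,1]` works in the converse (antitonicity of `SparseNPHardAt` in `ε`).
[cite: ChenJinWilliams2019, Thm. 1.1 (converse of item 1), TR19-118 p. 14] -/
theorem sparseNPHardAt_of_NPNotInFixedPolySize (h : NPNotInFixedPolySize) {ε : ℝ} (hε0 : 0 ≤ ε)
    (hε1 : ε ≤ 1) : SparseNPHardAt ε :=
  (sparseNPHardAt_one_of_NPNotInFixedPolySize h).mono hε0 hε1

/-- The printed EQUIVALENCE of Thm. 1.1 item 1 (`C = NP`) with only the magnification direction
left as a named-fact hypothesis: the sparse-language hypothesis (at some `ε > 0`) holds iff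
`NP ⊄ SIZE[n^k] ∀ k` (`sparseNPHard_iff` fed with `thm11_circuit_NP_converse_holds`).
[cite: ChenJinWilliams2019, Thm. 1.1 (item 1 and its converse), TR19-118 pp. 3–4, 14] -/
theorem sparseNPHard_iff_of_thm11 (h : thm11_circuit_NP) :
    (∃ ε : ℝ, 0 < ε ∧ SparseNPHardAt ε) ↔ NPNotInFixedPolySize :=
  sparseNPHard_iff h thm11_circuit_NP_converse_holds

end Literature.Computability.MetaComplexity.ChenJinWilliams2019
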